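/-
Copyright (c) 2026. All rights reserved.
Released under Apache 2.0 license as described in the file LICENSE.
Authors: abc-iut cell, seat abc-iut-L5-d1 (wave 3, gen 4).
-/
import Literature.IUT.LogVolume.UnitLogZetaThree
import Literature.IUT.LogVolume.AdicCompletionLogShell
import Literature.IUT.LogVolume.RescaledCompletionInvariants
import Literature.RingTheory.DiscreteValuationRing.AdicCompletionResidueField
import Mathlib.NumberTheory.NumberField.Cyclotomic.Ideal
import HarnessLib

/-!
# The log-shell of `ℚ(ζ₃)` at its ramified place `(ζ₃ - 1)` is EXACTLY the ring of integers: `ℐ_v = 𝒪_v`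

Proof-only file (theorems, no definitions), the instance of `UnitLogZetaThree.lean` at the `v`-adic
completion `F_v` of a number field `F` with `IsCyclotomicExtension {3} ℚ F` (i.e. `F = ℚ(ζ₃)`) at its
unique place `v ∣ 3` (`v = (ζ₃ - 1)`, ramification index `2`, residue field `𝔽₃`; Washington,
*Introduction to Cyclotomic Fields*, Lemma 1.4 — Mathlib `IsCyclotomicExtension.Rat.eq_span_zeta_sub_one_of_liesOver'`,
`absNorm_span_zeta_sub_one`). For abc-iut-S1's `p`-adic logarithm `unitLog` computed in abc-iut-S7's
rescaled completion (the analytic logarithm the cell's `Real.analyticLogv` is made of,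
`AdicCompletionLogShell.lean`):

* `valued_zeta_sub_one` — `|ζ₃ - 1|_v = exp(-1)` (`ζ₃ - 1` is a uniformizer of `F_v`);
* `valued_pow_three_sub_self_le` — `|x³ - x|_v ≤ |ζ₃ - 1|_v` for every `x ∈ 𝒪_v` (Fermat in the residue
  field `𝒪_v/𝔪_v ≅ 𝒪_F/v = 𝔽₃`, the tree's `residueFieldEquiv`);
* `norm_pow_three_sub_self_le_rescaled` — the same for the rescaled norm: the hypothesis `hres` of
  `UnitLogZetaThree.lean` HOLDS in `RescaledCompletion F 3 v hv`;
* `nonarchLogShell_adicCompletion_eq_integers` — **`ℐ_v := 3⁻¹ · log_v(𝒪_v^×) = 𝒪_v`** as subsets of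
  `F_v`, for any logarithm `logk` on `𝒪_v^×` given by the formula `logk u = unitLog u` (rescaled field):
  [IUTchIII] Rmk. 1.2.2 (i)'s log-shell at this ramified place is the closed unit ball — neither larger
  (as the general bound `log(𝒪^×) ⊆ p^{-b}𝒪`, `b = 1/2` here, [IUTchIV] Prop. 1.2 (i), would allow) nor
  smaller;
* `nonarchLogShell_adicCompletion_eq_integers'` — the same with the prime as a parameter `p = 3` (the
  shape consumed by `Summit.ABC.IUTFork.Thm311.Real.analyticLogv`, whose rescaling prime is
  `residueChar F v`), and `residueChar_eq_three`.

Consumer: `Summits/ABC/IUTFork/Cor312RamifiedPlaceLogShell.lean` (GAP-LEDGER G-c312-14-1 `hshell`: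
`∃ logv, LogvLaw logv ∧ ∃ c₀ ≠ 0, shell logv v = c₀ · 𝒪_v`, with `c₀ = 1`).
No new definitions; classical local analysis; no side is taken on [IUTchIII] Cor. 3.12.
-/

noncomputable section

namespace Literature.IUT.LogVolume

open NumberField IsDedekindDomain IsDedekindDomain.HeightOneSpectrum IsLocalRing
open Literature.IUT.LogThetaLattice Literature.NumberTheory.NumberFields

variable (F : Type) [Field F] [NumberField F] [hF : IsCyclotomicExtension {3} ℚ F]
  (v : HeightOneSpectrum (𝓞 F)) (hv : ((3 : ℕ) : 𝓞 F) ∈ v.asIdeal)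

/-! ## 1. The place `v ∣ 3` of `ℚ(ζ₃)`: `v = (ζ₃ - 1)`, `N(v) = 3`, `|ζ₃ - 1|_v = exp(-1)` -/

include hv in
/-- `v = (ζ₃ - 1)` for the (unique) place `v ∣ 3` of `ℚ(ζ₃)`. [cite: Washington1997, Lemma 1.4] -/
theorem asIdeal_eq_span_zeta_sub_one :
    v.asIdeal = Ideal.span {(IsCyclotomicExtension.zeta_spec 3 ℚ F).toInteger - 1} := by
  haveI := liesOver_span_of_natCast_mem F 3 v hv
  exact IsCyclotomicExtension.Rat.eq_span_zeta_sub_one_of_liesOver' 3 F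
    (IsCyclotomicExtension.zeta_spec 3 ℚ F) v.asIdeal

include hv in
/-- `N(v) = 3`: the residue field `𝒪_F / v` has three elements (`f(v|3) = 1`).
[cite: Washington1997, Lemma 1.4] -/
theorem absNorm_asIdeal_eq_three : Ideal.absNorm v.asIdeal = 3 := by
  haveI := liesOver_span_of_natCast_mem F 3 v hv
  rw [absNorm_eq_pow_inertiaDeg F 3 v hv, IsCyclotomicExtension.Rat.inertiaDeg_eq_of_prime 3 F v.asIdeal,
    pow_one]

omit hF in
include hv in
/-- The residue characteristic of `v` is `3`. [cite: Washington1997, Lemma 1.4] -/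
theorem residueChar_eq_three : residueChar F v = 3 := by
  haveI := liesOver_span_of_natCast_mem F 3 v hv
  exact (mem_placesOver_iff_residueChar v).mp ((mem_placesOver_iff v).mpr this)

include hv in
/-- The residue field of the completion `𝒪_v` has three elements (`𝒪_v/𝔪_v ≅ 𝒪_F/v`, the tree's
`residueFieldEquiv`). [cite: NeukirchANT1999, Ch. II Prop. (4.3)] -/
theorem natCard_residueField_eq_three :
    Nat.card (ResidueField (v.adicCompletionIntegers F)) = 3 := by
  rw [natCard_residueField_adicCompletionIntegers F v, ← Submodule.cardQuot_apply, ← Ideal.absNorm_apply,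
    absNorm_asIdeal_eq_three F v hv]

include hv in
/-- `ζ₃ - 1 ≠ 0` in `𝓞 F`. [cite: Washington1997, Lemma 1.4] -/
theorem toInteger_zeta_sub_one_ne_zero :
    (IsCyclotomicExtension.zeta_spec 3 ℚ F).toInteger - 1 ≠ 0 := by
  intro h0
  have h3 := absNorm_asIdeal_eq_three F v hv
  rw [asIdeal_eq_span_zeta_sub_one F v hv, h0, Ideal.span_singleton_zero, Ideal.absNorm_bot] at h3
  exact absurd h3 (by norm_num)

include hv in
/-- **`ζ₃ - 1` is a uniformizer of `F_v`**: `|ζ₃ - 1|_v = exp(-1)`. [cite: Washington1997, Lemma 1.4] -/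
theorem valued_zeta_sub_one :
    Valued.v (algebraMap (𝓞 F) (v.adicCompletion F)
      ((IsCyclotomicExtension.zeta_spec 3 ℚ F).toInteger - 1)) = WithZero.exp (-1 : ℤ) := by
  rw [IsScalarTower.algebraMap_apply (𝓞 F) F (v.adicCompletion F), algebraMap_adicCompletion,
    Function.comp_apply, valuedAdicCompletion_eq_valuation', Algebra.algebraMap_self, RingHom.id_apply,
    valuation_of_algebraMap]
  exact intValuation_singleton v (toInteger_zeta_sub_one_ne_zero F v hv)
    (asIdeal_eq_span_zeta_sub_one F v hv)

/-! ## 2. Fermat in the residue field: `|x³ - x|_v ≤ |ζ₃ - 1|_v` on `𝒪_v` -/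

include hv in
/-- Every `x ∈ 𝒪_v` satisfies `x³ - x ∈ 𝔪_v` (the residue field has `3` elements, so `r³ = r` there).
[cite: NeukirchANT1999, Ch. II Prop. (4.3)] -/
theorem pow_three_sub_self_mem_maximalIdeal (x : v.adicCompletionIntegers F) :
    x ^ 3 - x ∈ maximalIdeal (v.adicCompletionIntegers F) := by
  haveI : Finite (ResidueField (v.adicCompletionIntegers F)) :=
    Nat.finite_of_card_ne_zero (by rw [natCard_residueField_eq_three F v hv]; norm_num)
  letI : Fintype (ResidueField (v.adicCompletionIntegers F)) := Fintype.ofFinite _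
  have hcard : Fintype.card (ResidueField (v.adicCompletionIntegers F)) = 3 := by
    rw [← Nat.card_eq_fintype_card, natCard_residueField_eq_three F v hv]
  rw [← residue_eq_zero_iff, map_sub, map_pow]
  have h := FiniteField.pow_card (residue (v.adicCompletionIntegers F) x)
  rw [hcard] at h
  rw [h, sub_self]

include hv in
/-- … hence `|x³ - x|_v < 1` … [cite: NeukirchANT1999, Ch. II Prop. (4.3)] -/
theorem valued_pow_three_sub_self_lt_one (x : v.adicCompletionIntegers F) :
    Valued.v (((x : v.adicCompletion F)) ^ 3 - (x : v.adicCompletion F)) < 1 := by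
  have hmem := pow_three_sub_self_mem_maximalIdeal F v hv x
  have hnu : ¬ IsUnit (x ^ 3 - x) := (mem_nonunits_iff).mp (mem_maximalIdeal _ |>.mp hmem)
  rw [adicCompletionIntegers.isUnit_iff_valued_eq_one] at hnu
  have hle : Valued.v (((x ^ 3 - x : v.adicCompletionIntegers F)) : v.adicCompletion F) ≤ 1 :=
    (x ^ 3 - x).2
  have hlt := lt_of_le_of_ne hle hnu
  simpa using hlt

include hv in
/-- … and therefore `|x³ - x|_v ≤ |ζ₃ - 1|_v = exp(-1)` (discreteness of `|·|_v`).
[cite: Washington1997, Lemma 1.4] -/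
theorem valued_pow_three_sub_self_le (x : v.adicCompletion F) (hx : x ∈ v.adicCompletionIntegers F) :
    Valued.v (x ^ 3 - x) ≤
      Valued.v (algebraMap (𝓞 F) (v.adicCompletion F)
        ((IsCyclotomicExtension.zeta_spec 3 ℚ F).toInteger - 1)) := by
  have hlt := valued_pow_three_sub_self_lt_one F v hv ⟨x, hx⟩
  simp only at hlt
  rw [valued_zeta_sub_one F v hv]
  -- in `ℤᵐ⁰`, `< 1` is `≤ exp (-1)`
  rcases eq_or_ne (Valued.v (x ^ 3 - x)) 0 with h0 | h0
  · rw [h0]; exact bot_le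
  · rw [← WithZero.exp_log h0] at hlt ⊢
    rw [← WithZero.exp_zero, WithZero.exp_lt_exp] at hlt
    rw [WithZero.exp_le_exp]
    omega

/-! ## 3. The hypotheses of `UnitLogZetaThree` hold in the rescaled completion -/

/-- `ζ₃² + ζ₃ + 1 = 0` in `𝓞 F`. [cite: Washington1997, Lemma 1.4] -/
theorem toInteger_zeta_sq_add :
    (IsCyclotomicExtension.zeta_spec 3 ℚ F).toInteger ^ 2 +
      (IsCyclotomicExtension.zeta_spec 3 ℚ F).toInteger + 1 = 0 := by
  have hζ := (IsCyclotomicExtension.zeta_spec 3 ℚ F).geom_sum_eq_zero (by norm_num : 1 < 3)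
  have hF : (IsCyclotomicExtension.zeta 3 ℚ F) ^ 2 + IsCyclotomicExtension.zeta 3 ℚ F + 1 = 0 := by
    simp only [Finset.sum_range_succ, Finset.sum_range_zero, pow_zero, pow_one, zero_add] at hζ
    linear_combination hζ
  apply RingOfIntegers.coe_injective
  push_cast
  exact hF

/-- `ζ₃` in the rescaled completion satisfies `ζ² + ζ + 1 = 0`. [cite: Washington1997, Lemma 1.4] -/
theorem zeta_rescaled_sq_add :
    (RescaledCompletion.of F 3 v hv (algebraMap (𝓞 F) (v.adicCompletion F)
        (IsCyclotomicExtension.zeta_spec 3 ℚ F).toInteger)) ^ 2 +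
      RescaledCompletion.of F 3 v hv (algebraMap (𝓞 F) (v.adicCompletion F)
        (IsCyclotomicExtension.zeta_spec 3 ℚ F).toInteger) + 1 = 0 := by
  have h := congrArg (fun t : 𝓞 F => RescaledCompletion.of F 3 v hv (algebraMap (𝓞 F) (v.adicCompletion F) t))
    (toInteger_zeta_sq_add F)
  simpa only [map_add, map_pow, map_one, map_zero] using h

/-- **The residue hypothesis `hres` of `UnitLogZetaThree` in the rescaled completion**: for every
`s` with `‖s‖' ≤ 1` (i.e. `s ∈ 𝒪_v`), `‖s³ - s‖' ≤ ‖ζ₃ - 1‖'` (the rescaled norm is a monotone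
function of `|·|_v`). [cite: Washington1997, Lemma 1.4] -/
theorem norm_pow_three_sub_self_le_rescaled (s : RescaledCompletion F 3 v hv) (hs : ‖s‖ ≤ 1) :
    ‖s ^ 3 - s‖ ≤
      ‖RescaledCompletion.of F 3 v hv (algebraMap (𝓞 F) (v.adicCompletion F)
          (IsCyclotomicExtension.zeta_spec 3 ℚ F).toInteger) - 1‖ := by
  have hsO : s ∈ (v.adicCompletionIntegers F : ValuationSubring (RescaledCompletion F 3 v hv)) :=
    (mem_integers_iff_norm_rescaled_le_one F 3 v hv s).mpr hs
  have hval := valued_pow_three_sub_self_le F v hv s hsO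
  have hsub : RescaledCompletion.of F 3 v hv (algebraMap (𝓞 F) (v.adicCompletion F)
        (IsCyclotomicExtension.zeta_spec 3 ℚ F).toInteger) - 1 =
      RescaledCompletion.of F 3 v hv (algebraMap (𝓞 F) (v.adicCompletion F)
        ((IsCyclotomicExtension.zeta_spec 3 ℚ F).toInteger - 1)) := by
    rw [map_sub, map_one, map_sub, map_one]
  rw [hsub, RescaledCompletion.norm_def, RescaledCompletion.norm_def, NNReal.coe_le_coe]
  exact (WithZeroMulInt.toNNReal_strictMono (RescaledCompletion.one_lt_base F v)).monotone hval

/-! ## 4. `ℐ_v = 𝒪_v` at the ramified place of `ℚ(ζ₃)` -/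

/-- **`ℐ_v = 3⁻¹ · log_v(𝒪_v^×) = 𝒪_v`** for the completion of `ℚ(ζ₃)` at `v ∣ 3` and any logarithm
`logk` on `𝒪_v^×` given by abc-iut-S1's `unitLog` in the rescaled completion (the formula of the cell's
analytic family): the log-shell of [IUTchIII] Rmk. 1.2.2 (i) at this RAMIFIED place is exactly the ring
of integers (`UnitLogZetaThree.nonarchLogShell_three_eq_integers`, read back in `F_v` along the identity
— the sets only involve `𝒪_v` and `logk`). [cite: NeukirchANT1999, Ch. II Prop. (5.5)] -/
theorem nonarchLogShell_adicCompletion_eq_integers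
    (logk : Additive (↥(v.adicCompletionIntegers F))ˣ →+ v.adicCompletion F)
    (hlog : ∀ u : (↥(v.adicCompletionIntegers F))ˣ, logk (Additive.ofMul u) =
      (RescaledCompletion.of F 3 v hv).symm
        (unitLog (RescaledCompletion.of F 3 v hv (((u : ↥(v.adicCompletionIntegers F)) :
          v.adicCompletion F))))) :
    nonarchLogShell (v.adicCompletionIntegers F) logk 3 =
      (v.adicCompletionIntegers F : Set (v.adicCompletion F)) :=
  nonarchLogShell_three_eq_integers (K := RescaledCompletion F 3 v hv)
    (v.adicCompletionIntegers F : ValuationSubring (RescaledCompletion F 3 v hv))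
    (zeta_rescaled_sq_add F v hv) (norm_pow_three_sub_self_le_rescaled F v hv)
    (mem_integers_iff_norm_rescaled_le_one F 3 v hv) logk (fun u => hlog u)

/-- The same with the rescaling prime as a PARAMETER `p` (`= 3`): the shape in which the cell's
analytic family `Real.analyticLogv F v` is given (rescaling prime `residueChar F v`, cf.
`residueChar_eq_three`). [cite: NeukirchANT1999, Ch. II Prop. (5.5)] -/
theorem nonarchLogShell_adicCompletion_eq_integers' (p : ℕ) [Fact p.Prime]
    (hvp : ((p : ℕ) : 𝓞 F) ∈ v.asIdeal) (hp : p = 3)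
    (logk : Additive (↥(v.adicCompletionIntegers F))ˣ →+ v.adicCompletion F)
    (hlog : ∀ u : (↥(v.adicCompletionIntegers F))ˣ, logk (Additive.ofMul u) =
      (RescaledCompletion.of F p v hvp).symm
        (unitLog (RescaledCompletion.of F p v hvp (((u : ↥(v.adicCompletionIntegers F)) :
          v.adicCompletion F))))) :
    nonarchLogShell (v.adicCompletionIntegers F) logk p =
      (v.adicCompletionIntegers F : Set (v.adicCompletion F)) := by
  subst hp
  exact nonarchLogShell_adicCompletion_eq_integers F v hvp logk hlog

end Literature.IUT.LogVolume

end
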